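import Summits.ResolutionOfSingularities.ResolutionOfSingularities.Theorems.EquisingularLiftEquisingularLiftNatMarkedTower
import Summits.ResolutionOfSingularities.ResolutionOfSingularities.Theorems.EquisingularLiftEquisingularLiftNatTwoStepVertex
import HarnessLib

/-!
# [OURS] TOWER LEVELS ALONG OPEN IMMERSIONS and THE MARKED TOWER STEP AT A VERTEX OF `V₊(F)` (all levels) — the projective form of
# ✓ `OneStep.towerLevel_succ_origin_marked` (p836674), by the chart of ✓ `twoStepAt_vertex`
# (cruxes `Theses.EquisingularLift.EquisingularLiftNat` / `…NatThree` / `EquisingularLift`, stmt-ResolutionOfSingularities-20038 / -20148 / -15660)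

[OURS · leafhand-res-equisingularlift-12 g0, 2026-08-31; cell `pub/decomp-res`] AI-produced, weaker than expert review; NOT a statement of any manuscript;
nothing here proves resolution of singularities in positive characteristic.  DEF-FREE helper; no `sorry`; standard axioms; ZERO named hypotheses.

* ★★ `OneStep.towerLevel_of_openImmersion` — `D`-levels pass along an open immersion `ψ` with `ψ y₀ = x` (closed points): `D n X y₀ → D n Y x`
  (✓ `tower_loc` along `ψ.isoOpensRange` and the inclusion of the open range, ✓ `PointChain.isIso_ι_morphismRestrict_self`);
* ★★★ `towerLevel_succ_vertex_marked` — `F` a form of positive degree, vertex chart `F(x_c := 1) = Φ + Ψ` (radical) with MARKED chart data whose translates at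
  the marks have `D`-level `≤ d` at their origins ⟹ the point of `V₊(F)` over `P_c` has `D`-level `d + 1`.  With ✓ `isoHypPoint_of_towerPoints` this is the
  vertex-level input for «`A_k`/`D_k`/`E_k` vertices ⟹ `IsoHypPoint`» (remaining: the vertex bookkeeping of ✓ `isoHypPoint_of_twoStepVertices` with levels, S).

Honest label: closes no registered stub.

References: [Hartshorne1977, I Thm. 5.1, II Prop. 5.9]; [StacksProject, Tags 0804, 080E]; [GortzWedhorn2020, Prop. 13.91, (13.19)]; through the cited tree files.
-/

set_option linter.dupNamespace false -- mandated namespace `Summit.<Summit>.<Problem>` of this single-conjunct summit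

noncomputable section

open CategoryTheory CategoryTheory.Limits AlgebraicGeometry TopologicalSpace
open Literature.AlgebraicGeometry.Resolution Literature.AlgebraicGeometry.Motives
open AlgebraicGeometry.Scheme.IdealSheafData
open MvPolynomial HomogeneousLocalization
open Literature.AlgebraicGeometry.Motives.SmoothHypersurface Literature.AlgebraicGeometry.Motives.ProjectiveSpace
open Summit.ResolutionOfSingularities.ResolutionOfSingularities.Cruxes.EquisingularLift.StrataSplit

namespace Summit.ResolutionOfSingularities.ResolutionOfSingularities.Cruxes.EquisingularLiftNat.Sections

/-- ★★ **TOWER LEVELS PASS ALONG OPEN IMMERSIONS** (closed points): `ψ : X → Y` an open immersion, `ψ y₀ = x`, then `D n X y₀ → D n Y x` for every blow-up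
tower `D` — ✓ `tower_loc` along `ψ.isoOpensRange` and along the inclusion of the range. [OURS] [cite: GortzWedhorn2020, (13.19)] -/
theorem OneStep.towerLevel_of_openImmersion (D : ℕ → ∀ Γ : Scheme.{0}, Γ → Prop)
    (hD0 : ∀ (Γ : Scheme.{0}) (y : Γ), IsClosed (({y} : Set Γ)) →
      (D 0 Γ y ↔ ∀ (hy : IsClosed (({y} : Set Γ))) (Z : Scheme.{0}) (τ : Z ⟶ Γ), IsBlowup τ (vanishingIdeal ⟨{y}, hy⟩) →
        ∀ z : Z, τ z = y → IsRegularLocalRing (Z.presheaf.stalk z)))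
    (hDsucc : ∀ (d : ℕ) (Γ : Scheme.{0}) (y : Γ), IsClosed (({y} : Set Γ)) →
      (D (d + 1) Γ y ↔ ∀ (hy : IsClosed (({y} : Set Γ))) (Z : Scheme.{0}) (τ : Z ⟶ Γ), IsBlowup τ (vanishingIdeal ⟨{y}, hy⟩) →
        ∃ S' : Finset Z, (∀ z : Z, τ z = y → z ∉ S' → IsRegularLocalRing (Z.presheaf.stalk z)) ∧
          ∀ z ∈ S', τ z = y ∧ IsClosed (({z} : Set Z)) ∧ ∃ d' ≤ d, D d' Z z))
    (n : ℕ) {X₀ Y : Scheme.{0}} (ψ : X₀ ⟶ Y) [IsOpenImmersion ψ] {y₀ : X₀} {x : Y} (hψx : ψ y₀ = x)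
    (hy₀cl : IsClosed ({y₀} : Set X₀)) (hxcl : IsClosed ({x} : Set Y)) (h : D n X₀ y₀) : D n Y x := by
  have hloc := tower_loc D hD0 hDsucc n
  let U : Y.Opens := ψ.opensRange
  let e := ψ.isoOpensRange
  have hψU : ∀ v, U.ι (e.hom v) = ψ v := fun v => by
    rw [← Scheme.Hom.comp_apply, Scheme.Hom.isoOpensRange_hom_ι]
  have hxU : x ∈ U := ⟨y₀, hψx⟩
  have hucl : IsClosed ({e.hom y₀} : Set (U : Scheme.{0})) :=
    PointChain.isClosed_singleton_of_injective U.ι U.ι.isOpenEmbedding.injective (by rw [hψU, hψx]; exact hxcl)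
  have he' : e.inv (e.hom y₀) = y₀ := by
    change (e.hom ≫ e.inv) y₀ = y₀
    rw [e.hom_inv_id]
    rfl
  haveI : IsIso (e.inv ∣_ (⊤ : X₀.Opens)) := inferInstance
  have hu : D n (U : Scheme.{0}) (e.hom y₀) :=
    (hloc _ _ e.inv ⊤ inferInstance y₀ (Set.mem_univ _) hy₀cl (e.hom y₀) he' hucl).mp h
  haveI := PointChain.isIso_ι_morphismRestrict_self U
  exact (hloc _ _ U.ι U inferInstance x hxU hxcl (e.hom y₀) ((hψU y₀).trans hψx) hucl).mpr hu

/-- ★★★ **THE MARKED TOWER STEP AT A VERTEX OF `V₊(F)`, ALL LEVELS**: `F` a form of positive degree whose vertex chart `F(x_c := 1) = Φ + Ψ` (radical) carries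
marked chart data with every translate at a mark on the strict transform of `D`-level `≤ d` at its origin ⟹ the point of `V₊(F)` over `P_c` is a closed point of
`D`-level `d + 1`, for every blow-up tower `D`.  Proof of ✓ `twoStepAt_vertex` verbatim (chart `ψ = Spec θ ≫ chart F c`, point identity `ψ y₀ = x₀`), last line
↦ ✓ `OneStep.towerLevel_succ_origin_marked` + `OneStep.towerLevel_of_openImmersion`. [OURS] [cite: Hartshorne1977, II Prop. 5.9] [cite: StacksProject, Tag 0804] -/
theorem towerLevel_succ_vertex_marked (K : Type) [Field K] {m : ℕ} (D : ℕ → ∀ Γ : Scheme.{0}, Γ → Prop)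
    (hD0 : ∀ (Γ : Scheme.{0}) (y : Γ), IsClosed (({y} : Set Γ)) →
      (D 0 Γ y ↔ ∀ (hy : IsClosed (({y} : Set Γ))) (Z : Scheme.{0}) (τ : Z ⟶ Γ), IsBlowup τ (vanishingIdeal ⟨{y}, hy⟩) →
        ∀ z : Z, τ z = y → IsRegularLocalRing (Z.presheaf.stalk z)))
    (hDsucc : ∀ (d : ℕ) (Γ : Scheme.{0}) (y : Γ), IsClosed (({y} : Set Γ)) →
      (D (d + 1) Γ y ↔ ∀ (hy : IsClosed (({y} : Set Γ))) (Z : Scheme.{0}) (τ : Z ⟶ Γ), IsBlowup τ (vanishingIdeal ⟨{y}, hy⟩) →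
        ∃ S' : Finset Z, (∀ z : Z, τ z = y → z ∉ S' → IsRegularLocalRing (Z.presheaf.stalk z)) ∧
          ∀ z ∈ S', τ z = y ∧ IsClosed (({z} : Set Z)) ∧ ∃ d' ≤ d, D d' Z z))
    (d : ℕ) (F : MvPolynomial (Fin (m + 2 + 1)) K) {d₀ : ℕ} (hF : F.IsHomogeneous d₀) (hd : 0 < d₀)
    (c : Fin (m + 2 + 1)) (Φ Ψ : MvPolynomial (Fin (m + 2)) K) {μ : ℕ} (hμ : 1 ≤ μ) (hΦ : Φ.IsHomogeneous μ) (hΦ0 : Φ ≠ 0)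
    (hΨ : Ψ ∈ Ideal.span (Set.range (X : Fin (m + 2) → MvPolynomial (Fin (m + 2)) K)) ^ (μ + 1))
    (hdeh : ProjectiveSpace.dehomogenize K c F = Φ + Ψ) (hrad : (Ideal.span {Φ + Ψ}).radical = Ideal.span {Φ + Ψ})
    (G : Fin (m + 2) → MvPolynomial (Fin (m + 2)) K)
    (hG : ∀ a, aeval (fun j => X a * Function.update (X : Fin (m + 2) → MvPolynomial (Fin (m + 2)) K) a 1 j) (Φ + Ψ) = X a ^ μ * G a)
    (Marks : Fin (m + 2) → Finset (Fin (m + 2) → K))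
    (hjac : ∀ a, ∀ P : Ideal (MvPolynomial (Fin (m + 2)) K), P.IsPrime → (X a : MvPolynomial (Fin (m + 2)) K) ∈ P → G a ∈ P →
      (∃ j, pderiv j (G a) ∉ P) ∨ ∃ lam ∈ Marks a, ∀ i, (X i - C (lam i) : MvPolynomial (Fin (m + 2)) K) ∈ P)
    (hlev : ∀ a, ∀ lam ∈ Marks a, G a ∈ Ideal.span (Set.range fun i : Fin (m + 2) => (X i - C (lam i) : MvPolynomial (Fin (m + 2)) K)) →
      ∃ (μ' : ℕ) (Φ' Ψ' : MvPolynomial (Fin (m + 2)) K), 1 ≤ μ' ∧ Φ'.IsHomogeneous μ' ∧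
        Ψ' ∈ Ideal.span (Set.range (X : Fin (m + 2) → MvPolynomial (Fin (m + 2)) K)) ^ (μ' + 1) ∧
        aeval (fun i => X i + C (lam i)) (G a) = Φ' + Ψ' ∧
        ∀ y' : Spec (CommRingCat.of (MvPolynomial (Fin (m + 2)) K ⧸ Ideal.span {Φ' + Ψ'})),
          y'.asIdeal = Ideal.map (Ideal.Quotient.mk (Ideal.span {Φ' + Ψ'}))
            (Ideal.span (Set.range (X : Fin (m + 2) → MvPolynomial (Fin (m + 2)) K))) →
          ∃ d' ≤ d, D d' (Spec (CommRingCat.of (MvPolynomial (Fin (m + 2)) K ⧸ Ideal.span {Φ' + Ψ'}))) y') :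
    letI := MvPolynomial.gradedAlgebra (σ := Fin (m + 2 + 1)) (R := K)
    ∃ (x₀ : ↥(hypersurface F).left) (_ : IsClosed ({x₀} : Set ↥(hypersurface F).left)),
      (∀ a : Fin (m + 2 + 1), a ≠ c → (X a : MvPolynomial (Fin (m + 2 + 1)) K) ∈ ((hypersurfaceι F).left x₀).asHomogeneousIdeal) ∧
      D (d + 1) (hypersurface F).left x₀ := by
  letI := MvPolynomial.gradedAlgebra (σ := Fin (m + 2 + 1)) (R := K)
  letI := MvPolynomial.gradedAlgebra (σ := Fin (0 + 1)) (R := K)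
  letI := ProjBaseChange.algebraBase (R := K) (homogeneousSubmodule (Fin (m + 2 + 1)) K)
    (Submonoid.powers (X c : MvPolynomial (Fin (m + 2 + 1)) K))
  classical
  -- the kill map of the vertex `P_c`
  have he : Function.Injective (fun _ : Fin 1 => c) := Function.injective_of_subsingleton _
  obtain ⟨fk, hfk', hfkC, hfke, hfk0⟩ := LinearCentre.exists_kill (R := K) (fun _ : Fin 1 => c) he
  have hfke' : ∀ j : Fin 1, fk (X c) = X j := fun j => hfke j
  have hfk0' : ∀ i : Fin (m + 2 + 1), i ≠ c → fk (X i) = 0 := fun i hi => hfk0 i (fun ⟨_, hj⟩ => hi hj.symm)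
  -- the vertex point
  obtain ⟨x₀, hx₀cl, hx₀cl', hsupp, hx₀X, hΛ, hcomap⟩ :=
    exists_vertexPoint K F hF c ⟨μ, Φ, Ψ, hμ, hΦ, hΨ, hdeh⟩ fk hfk' hfkC hfke' hfk0'
  refine ⟨x₀, hx₀cl', hx₀X, ?_⟩
  -- the chart `ψ = Spec θ ≫ chart F c`
  obtain ⟨θ, hθ⟩ := HypersurfaceSpecimen.exists_chartQuotEquiv F hF c (Φ + Ψ) hdeh hrad
  let ψ : Spec (CommRingCat.of (MvPolynomial (Fin (m + 2)) K ⧸ Ideal.span {Φ + Ψ})) ⟶ (hypersurface F).left :=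
    Spec.map θ.toCommRingCatIso.hom ≫ (chart F c hF hd).left
  haveI : IsOpenImmersion (Spec.map θ.toCommRingCatIso.hom) := IsOpenImmersion.of_isIso _
  haveI : @IsOpenImmersion (Spec (CommRingCat.of (ChartRing F c hF))) _ (chart F c hF hd).left :=
    isOpenImmersion_chart_left F c hF hd
  haveI : IsOpenImmersion ψ := IsOpenImmersion.comp _ _
  -- the origin and its image
  let y₀ : Spec (CommRingCat.of (MvPolynomial (Fin (m + 2)) K ⧸ Ideal.span {Φ + Ψ})) :=
    ⟨Ideal.map (Ideal.Quotient.mk (Ideal.span {Φ + Ψ})) (Ideal.span (Set.range (X : Fin (m + 2) → MvPolynomial (Fin (m + 2)) K))),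
      (OneStep.isMaximal_map_mk_span_range_X K Φ Ψ hμ hΦ hΨ).isPrime⟩
  have hy₀ : y₀.asIdeal = Ideal.map (Ideal.Quotient.mk (Ideal.span {Φ + Ψ}))
      (Ideal.span (Set.range (X : Fin (m + 2) → MvPolynomial (Fin (m + 2)) K))) := rfl
  -- the vertex ideal pulled back to the chart is the origin ideal of `ChartRing F c`
  have hchart := HypersurfaceSpecimen.comap_chart_eq_ofIdealTop K F hF hd (fun _ : Fin 1 => c) he fk hfk' hfkC hfke hfk0 c
  -- the origin ideal of `ChartRing F c` goes into the origin ideal of `K[y]/(f)` under `θ`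
  have hI₀ : ∀ q ∈ Ideal.span (Set.range fun a : {a : Fin (m + 2 + 1) // a ∉ Set.range (fun _ : Fin 1 => c)} => tautVec F c hF a.1),
      θ q ∈ y₀.asIdeal := by
    intro q hq
    have hle : Ideal.span (Set.range fun a : {a : Fin (m + 2 + 1) // a ∉ Set.range (fun _ : Fin 1 => c)} => tautVec F c hF a.1) ≤
        y₀.asIdeal.comap θ.toRingHom := by
      rw [Ideal.span_le]
      rintro _ ⟨⟨a, ha⟩, rfl⟩
      obtain ⟨j, hj⟩ : ∃ j : Fin (m + 2), c.succAbove j = a := Fin.exists_succAbove_eq (fun h => ha ⟨0, h.symm⟩)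
      rw [SetLike.mem_coe, Ideal.mem_comap]
      change θ (tautVec F c hF a) ∈ y₀.asIdeal
      rw [← hj, hθ j, hy₀]
      exact Ideal.mem_map_of_mem _ (Ideal.subset_span ⟨j, rfl⟩)
    exact hle hq
  have hψx : ψ y₀ = x₀ := by
    -- the point `p₀ = Spec θ (y₀)` of the chart lies on the pulled-back vertex ideal
    have hsurj : Function.Surjective (Scheme.ΓSpecIso (CommRingCat.of (ChartRing F c hF))).inv :=
      (ConcreteCategory.bijective_of_isIso (C := CommRingCat) (Scheme.ΓSpecIso (CommRingCat.of (ChartRing F c hF))).inv).2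
    have hinj : Function.Injective (Scheme.ΓSpecIso (CommRingCat.of (ChartRing F c hF))).inv :=
      (ConcreteCategory.bijective_of_isIso (C := CommRingCat) (Scheme.ΓSpecIso (CommRingCat.of (ChartRing F c hF))).inv).1
    -- the chart morphism with source typed as `Spec (ChartRing F c)`
    have hchart' : Scheme.IdealSheafData.comap (X := Spec (CommRingCat.of (ChartRing F c hF)))
        (((Proj.map fk hfk').ker.comap (hypersurfaceι F).left)) (chart F c hF hd).left =
        ofIdealTop ((Ideal.span (Set.range fun a : {a : Fin (m + 2 + 1) // a ∉ Set.range (fun _ : Fin 1 => c)} => tautVec F c hF a.1)).map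
          (Scheme.ΓSpecIso (CommRingCat.of (ChartRing F c hF))).inv.hom) := hchart
    have hp : Spec.map θ.toCommRingCatIso.hom y₀ ∈
        ((Scheme.IdealSheafData.comap (X := Spec (CommRingCat.of (ChartRing F c hF)))
          (((Proj.map fk hfk').ker.comap (hypersurfaceι F).left)) (chart F c hF hd).left).support :
            Set (Spec (CommRingCat.of (ChartRing F c hF)))) := by
      rw [hchart', Scheme.IdealSheafData.coe_support_ofIdealTop, Spec_zeroLocus, Spec.map_apply]
      refine (PrimeSpectrum.mem_zeroLocus _ _).mpr ?_
      intro r hr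
      obtain ⟨r', hr', hrr'⟩ := (Ideal.mem_map_iff_of_surjective _ hsurj).mp hr
      have hr'' : r = r' := hinj hrr'.symm
      subst hr''
      rw [SetLike.mem_coe, PrimeSpectrum.comap_asIdeal, Ideal.mem_comap]
      exact hI₀ r hr'
    rw [Scheme.IdealSheafData.support_comap] at hp
    change (chart F c hF hd).left (Spec.map θ.toCommRingCatIso.hom y₀) ∈
      ((((Proj.map fk hfk').ker.comap (hypersurfaceι F).left)).support : Set ↥(hypersurface F).left) at hp
    rw [hcomap, Scheme.IdealSheafData.coe_support_vanishingIdeal] at hp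
    exact hp
  have hy₀cl : IsClosed ({y₀} : Set (Spec (CommRingCat.of (MvPolynomial (Fin (m + 2)) K ⧸ Ideal.span {Φ + Ψ})))) :=
    (PrimeSpectrum.isClosed_singleton_iff_isMaximal y₀).mpr (OneStep.isMaximal_map_mk_span_range_X K Φ Ψ hμ hΦ hΨ)
  have hlev0 := OneStep.towerLevel_succ_origin_marked K D hD0 hDsucc d Φ Ψ hμ hΦ hΦ0 hΨ G hG Marks hjac hlev y₀ hy₀
  exact OneStep.towerLevel_of_openImmersion D hD0 hDsucc (d + 1) ψ hψx hy₀cl hx₀cl' hlev0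

end Summit.ResolutionOfSingularities.ResolutionOfSingularities.Cruxes.EquisingularLiftNat.Sections

end
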